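import Literature.NumberTheory.EllipticCurves.PAdicTwoVariableColemanImageCocycleOfUnitsGalois
import Literature.NumberTheory.GaloisRepresentations.LubinTateColemanCoordCoinvariantCosetTwo
import Literature.NumberTheory.GaloisRepresentations.LubinTateColemanUnitsImageTraceTwo
import HarnessLib

/-!
# The two-variable Coleman image of the PRODUCT RULE `σ̃_𝔞·β_𝔠 · β_𝔞^{N𝔠} = β_{𝔞𝔠}` with ONE Galois index: for a liftable `𝔞` acting on an
# ARBITRARY (possibly non-liftable) `𝔠`, `Col β_{𝔞𝔠} = 𝒯_{σ̃_𝔞}(Col β_𝔠) + N𝔠 • Col β_𝔞`; on the `ℤ/d`-trace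
# `Σ Col β_{𝔞𝔠} = σ_{χ(σ̃_𝔞)}(C g_𝔞 • Σ Col β_𝔠) + N𝔠 • Σ Col β_𝔞`; on the `ε`-coinvariants
# `φ_ε(Σ Col β_{𝔞𝔠}) = (t_𝔞·C g_𝔞)·φ_ε(Σ Col β_𝔠) + N𝔠·φ_ε(Σ Col β_𝔞)` — the second coset component of de Shalit's measure read at one prime

De Shalit, *Iwasawa theory of elliptic curves with complex multiplication* (1987), II §2.4 (ii) (`e(𝔞)^{σ_𝔟 − N𝔟} = e(𝔟)^{σ_𝔞 − N𝔞}` for ALL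
integral `𝔞, 𝔟` prime to `6𝔣`), II §4.12 (29)–(33), III §1.3–1.4.  The tree's (c)-capstone
(`…ColemanCoinvariantCharTraceEllipticUnitsFrameDischargedSplit`, T15) works at ONE prime `𝔓 ∣ 𝔭` with the index set of ideals `𝔞` whose Artin
symbol has a local lift `σ̃_𝔞 ∈ Γ_{K_𝔭}` ("liftable": the symbol lies in the decomposition group `D` of `𝔓`), and the SYMMETRIC cocycle of
`PAdicTwoVariableColemanImageCocycleOfUnitsGalois` (both indices liftable).  When `[G : D] > 1` (memo BRICK-C-PADIC-g20 F26: index `2` for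
`K = ℚ(√−7)`, `𝔤 = (√−7)v̄³`) the semi-local `χ`-coinvariants also see the `𝔓`-components of the NON-liftable elliptic units `e(𝔠)`, `σ_𝔠 ∉ D`.
The product rule of the elliptic-unit files (`galAct_ellipticUnitsPrincipal₂_mul_pow`: `σ̃_𝔞·⟨e(𝔠)⟩ · ⟨e(𝔞)⟩^{N𝔠} = ⟨e(𝔞𝔠)⟩`) needs a local lift for
`𝔞` ONLY — `𝔠` is arbitrary.  THIS file reads that ONE-SIDED rule through the Coleman transform (everything PROVED, 0 sorry, no definitions,
no named facts; hypotheses are exactly the shapes `galAct_ellipticUnitsPrincipal₂_mul_pow` and `colemanImage_galAct` provide):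

* §1 (pure algebra) `map_eq_add_natCast_smul_of_act_mul_pow_eq` — under any `Col` with `Col(bb′) = Col b + Col b′`, `Col 1 = 0`,
  `Col ∘ act = tw ∘ Col`: **`act b₁ · b₂^n = b₃ ⟹ Col b₃ = tw (Col b₁) + n • Col b₂`**;
* §2 (two-variable tower, `q = 2`) ★★ **`colemanImage_eq_galOpₗ_add_smul_of_mul_pow_eq`** — for baseNorm-coherent `β₁, β₂, β₃` with
  `(σ̃·β₁(m))·β₂(m)^n = β₃(m)` at every level and `(g, s)` an Amice pair of `σ̃|_{E_∞}`:
  **`Col β₃ = galOpₗ (χ_π σ̃) g s (Col β₁) + C n • Col β₂`** (`colemanImage_galAct` + additivity); the submonoid form `colemanImageCoh_eq_…`;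
* §3 ★★ **`indexTraceₗ_colemanImage_eq_of_mul_pow_eq`** — on the `ℤ/d`-trace the shift disappears:
  **`Σ Col β₃ = σ_{χ_π σ̃}(C g • Σ Col β₁) + C n • Σ Col β₂`** (`indexTraceₗ_galOpₗ`), and its CONJUGATE-FAMILY reading
  `indexTraceₗ_colemanImage_sub_smul_eq_conj` : `Σ Col β₃ − N • Σ Col β₁ = C n • Σ Col β₂ + (σ_{χσ̃}(C g • Σ Col β₁) − N • Σ Col β₁)` — the shape
  `x′_𝔞 = N𝔟 • x_𝔞 + (𝒯_𝔞 y − N𝔞 • y)` of `LubinTateColemanCoordCoinvariantCosetTwo` (`CosetCocycle.conj_rel`, II §2.4 (ii): `(σ_𝔠 e(𝔞))_𝔓`);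
* §4 ★★★ **`colemanDeltaCoinvFun_indexTraceₗ_colemanImage_eq_of_mul_pow_eq`** — on the `ε`-coinvariants (`φ_ε`, `ε² = 1`):
  **`φ_ε(Σ Col β₃) = (t_{χσ̃}·C g)·φ_ε(Σ Col β₁) + C n·φ_ε(Σ Col β₂)`**, and with the (c)-capstone's value `φ_ε(Σ Col β₂) = (t_{χσ̃}·C g − N)·L`
  (`hL` of T15 at the liftable index): ★★★ **`colemanDeltaCoinvFun_indexTraceₗ_colemanImage_eq_of_mul_pow_eq_of_eq_mul`**
  **`φ_ε(Σ Col β₃) = (t_{χσ̃}·C g)·φ_ε(Σ Col β₁) + C n·(t_{χσ̃}·C g − N)·L`** — so the ONE new constant per non-liftable coset is `φ_ε(Σ Col e(𝔠))`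
  (de Shalit's second component `μ_τ`, II §4.12 with `i` semi-local; memo F26′/F26″).

For the elliptic units (Summits sequel): `β₁ = ⟨e(𝔠)⟩`, `β₂ = ⟨e(𝔞)⟩`, `β₃ = ⟨e(𝔞𝔠)⟩`, `σ̃ = σ̃_𝔞`, `n = N𝔠`, `N = N𝔞`.
Cell `bsd-print-cf2`, width seat `bsd-line-cf2c-w7` g21; crux of record stmt-BirchSwinnertonDyer-24033 (supports only; BSD is not proved by this).

## References
* E. de Shalit, *Iwasawa theory of elliptic curves with complex multiplication* (1987), Ch. I §3.1, §3.4 Lemma (i)–(ii), §3.8 (17); Ch. II §2.4 (ii),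
  §4.12 (29)–(33), §4.14 Step 1; Ch. III §1.3, §1.4 (5). [deShalit1987]
-/

noncomputable section

namespace Literature.NumberTheory.EllipticCurves

/-! ### §1. Pure algebra: the one-sided product rule under a logarithm-like map -/

section Algebra

/-- ★ **`act b₁ · b₂^n = b₃ ⟹ Col b₃ = tw (Col b₁) + n • Col b₂`** for any `Col : B → M` with `Col(bb′) = Col b + Col b′`, `Col 1 = 0` and
`Col (act b) = tw (Col b)` — the one-sided product rule `σ̃_𝔞·β_𝔠 · β_𝔞^{N𝔠} = β_{𝔞𝔠}` read additively. [cite: deShalit1987, Ch. II §2.4 (ii), §4.12 (29)] -/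
theorem map_eq_add_natCast_smul_of_act_mul_pow_eq {R M B : Type*} [Semiring R] [AddCommMonoid M] [Module R M] [Monoid B] (Col : B → M)
    (hmul : ∀ b b' : B, Col (b * b') = Col b + Col b') (hone : Col 1 = 0) (act : B → B) (tw : M → M)
    (hact : ∀ b : B, Col (act b) = tw (Col b)) {b₁ b₂ b₃ : B} {n : ℕ} (h : act b₁ * b₂ ^ n = b₃) :
    Col b₃ = tw (Col b₁) + (n : R) • Col b₂ := by
  rw [← h, hmul, hact, map_pow_eq_natCast_smul_of_map_mul (R := R) Col hmul hone]

end Algebra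

/-! ### §2. The two-variable tower at `q = 2`: `Col β₃ = 𝒯_{σ̃}(Col β₁) + n • Col β₂` -/

section TwoVariable

open ValuativeRel IsLocalRing Field
open Literature.NumberTheory.GaloisRepresentations Literature.NumberTheory.GaloisRepresentations.IsNonarchimedeanLocalField
  Literature.NumberTheory.GaloisRepresentations.LubinTate

variable {F : Type} [Field F] [ValuativeRel F] [TopologicalSpace F] [IsNonarchimedeanLocalField F]

attribute [local instance] ltNormUniformSpace ltNormIsUniformAddGroup rk1 nF nE fintypeResidueField
attribute [local instance] RelNormCoherentUnits.instCommMonoid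

variable {p : ℕ} [hp : Fact p.Prime] {d : ℕ} (hd : d.Coprime p)
variable {π : 𝒪[F]} (hπ : (valuation F).IsUniformizer (π : F))
variable (E : ℕ → IntermediateField F (AlgebraicClosure F)) [∀ m, FiniteDimensional F (E m)] [∀ m, Normal F (E m)]
  [∀ m, IsGalois F (E m)] (hmono : Monotone E) (hE : ∀ m, E m ≤ maxUnramified F) (hdeg : ∀ m, Module.finrank F (E m) = d * p ^ m)
  {σ₀ : absoluteGaloisGroup F} (hσ₀ : IsAbsArithFrob σ₀) (hq : residueFieldCard F = 2)
variable (u : (LTCoeff F)ˣ) (hu : LTCoeff.of F π = residueFieldCard F * u) (γ : 𝒪[F]ˣ)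
variable [IsAdicComplete (Ideal.span {intBase F (LTCoeff.of F π)}) (PowerSeries 𝒪[F])]
variable [NeZero d] [IsAdicComplete (Ideal.span {(p : 𝒪[F])}) 𝒪[F]]
variable {θ : ∀ m, unitBall (E m)} (hθ : ∀ m, IsIntegralNormalGen (E m) (θ m))
  (hcoh : ∀ m, unitBallTrace (hmono (Nat.le_succ m)) (θ (m + 1)) = θ m)

include hdeg in
/-- ★★ **`Col β₃ = 𝒯_{σ̃}(Col β₁) + C n • Col β₂`** on the submonoid of coherent families: from `σ̃·β₁ · β₂^n = β₃` and an Amice pair `(g, s)` of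
`σ̃|_{E_∞}`, `Col β₃ = galOpₗ (χ_π σ̃) g s (Col β₁) + C n • Col β₂`. [cite: deShalit1987, Ch. II §2.4 (ii), §4.12 (29); Ch. I §3.8 (17)] -/
theorem colemanImageCoh_eq_galOpₗ_add_smul_of_mul_pow_eq (β₁ β₂ β₃ : coherentFamilies hπ E hmono) (σ : absoluteGaloisGroup F)
    {g : PowerSeries 𝒪[F]} {s : ZMod d}
    (hg : ∀ m, ∃ a : ℕ, (∀ x : E m, σ • (x : AlgebraicClosure F) = (σ₀ ^ a) • (x : AlgebraicClosure F)) ∧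
      ((1 + PowerSeries.X : PowerSeries 𝒪[F]) ^ p ^ m - 1) ∣ g - (1 + PowerSeries.X) ^ a ∧ (a : ZMod d) = s)
    {n : ℕ} (h : galActCoherent hπ E hmono σ β₁ * β₂ ^ n = β₃) :
    colemanImageCoh hd hπ E hmono hE hdeg hσ₀ hq u hu γ hθ hcoh β₃ =
      galOpₗ hπ hq u hu γ (lubinTateChar hπ σ) g s (colemanImageCoh hd hπ E hmono hE hdeg hσ₀ hq u hu γ hθ hcoh β₁) +
        (PowerSeries.C ((n : ℕ) : PowerSeries 𝒪[F]) : PowerSeries (PowerSeries 𝒪[F])) •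
          colemanImageCoh hd hπ E hmono hE hdeg hσ₀ hq u hu γ hθ hcoh β₂ := by
  rw [map_natCast]
  exact map_eq_add_natCast_smul_of_act_mul_pow_eq (R := PowerSeries (PowerSeries 𝒪[F]))
    (colemanImageCoh hd hπ E hmono hE hdeg hσ₀ hq u hu γ hθ hcoh) (colemanImageCoh_mul hd hπ E hmono hE hdeg hσ₀ hq u hu γ hθ hcoh)
    (colemanImageCoh_one hd hπ E hmono hE hdeg hσ₀ hq u hu γ hθ hcoh) (galActCoherent hπ E hmono σ)
    (galOpₗ hπ hq u hu γ (lubinTateChar hπ σ) g s)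
    (fun b => colemanImageCoh_galAct_amice hd hπ E hmono hE hdeg hσ₀ hq u hu γ hθ hcoh b σ hg) h

include hdeg in
/-- ★★ **`Col β₃ = 𝒯_{σ̃}(Col β₁) + C n • Col β₂`** for baseNorm-coherent families `β₁, β₂, β₃` with the LEVELWISE one-sided product rule
`(σ̃·β₁(m))·β₂(m)^n = β₃(m)` (the shape of `galAct_ellipticUnitsPrincipal₂_mul_pow`: a local lift is needed for the ACTING index only) and an Amice
pair `(g, s)` of `σ̃|_{E_∞}`. [cite: deShalit1987, Ch. II §2.4 (ii), §4.12 (29); Ch. I §3.4 Lemma (i)–(ii), §3.8 (17)] -/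
theorem colemanImage_eq_galOpₗ_add_smul_of_mul_pow_eq {β₁ β₂ β₃ : ∀ m, RelNormCoherentUnits hπ (E m)}
    (hβ₁ : ∀ m, (β₁ (m + 1)).baseNorm hπ (hmono (Nat.le_succ m)) = β₁ m)
    (hβ₂ : ∀ m, (β₂ (m + 1)).baseNorm hπ (hmono (Nat.le_succ m)) = β₂ m)
    (hβ₃ : ∀ m, (β₃ (m + 1)).baseNorm hπ (hmono (Nat.le_succ m)) = β₃ m)
    (σ : absoluteGaloisGroup F) {g : PowerSeries 𝒪[F]} {s : ZMod d}
    (hg : ∀ m, ∃ a : ℕ, (∀ x : E m, σ • (x : AlgebraicClosure F) = (σ₀ ^ a) • (x : AlgebraicClosure F)) ∧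
      ((1 + PowerSeries.X : PowerSeries 𝒪[F]) ^ p ^ m - 1) ∣ g - (1 + PowerSeries.X) ^ a ∧ (a : ZMod d) = s)
    {n : ℕ} (h : ∀ m, (β₁ m).galAct σ * β₂ m ^ n = β₃ m) :
    colemanImage hd hπ E hmono hE hdeg hσ₀ hq u hu γ hθ hcoh hβ₃ =
      galOpₗ hπ hq u hu γ (lubinTateChar hπ σ) g s (colemanImage hd hπ E hmono hE hdeg hσ₀ hq u hu γ hθ hcoh hβ₁) +
        (PowerSeries.C ((n : ℕ) : PowerSeries 𝒪[F]) : PowerSeries (PowerSeries 𝒪[F])) •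
          colemanImage hd hπ E hmono hE hdeg hσ₀ hq u hu γ hθ hcoh hβ₂ := by
  have h' : galActCoherent hπ E hmono σ ⟨β₁, hβ₁⟩ * (⟨β₂, hβ₂⟩ : coherentFamilies hπ E hmono) ^ n = ⟨β₃, hβ₃⟩ :=
    Subtype.ext (funext fun m => by
      simp only [Submonoid.coe_mul, SubmonoidClass.coe_pow, Pi.mul_apply, Pi.pow_apply, coe_galActCoherent]
      exact h m)
  have key := colemanImageCoh_eq_galOpₗ_add_smul_of_mul_pow_eq hd hπ E hmono hE hdeg hσ₀ hq u hu γ hθ hcoh ⟨β₁, hβ₁⟩ ⟨β₂, hβ₂⟩ ⟨β₃, hβ₃⟩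
    σ hg h'
  simp only [colemanImageCoh_def] at key
  exact key

/-! ### §3. On the `ℤ/d`-trace: `Σ Col β₃ = σ_{χσ̃}(C g • Σ Col β₁) + C n • Σ Col β₂` -/

include hdeg in
/-- ★★ **THE TRACE FORM** `Σ Col β₃ = σ_{χ_π σ̃}(C g • Σ Col β₁) + C n • Σ Col β₂` — the `ℤ/d`-shift of `𝒯_{σ̃}` is invisible on the trace
(`indexTraceₗ_galOpₗ`).  For the elliptic units: `Σ Col ⟨e(𝔞𝔠)⟩ = σ_{χ(σ̃_𝔞)}(C g_𝔞 • Σ Col ⟨e(𝔠)⟩) + N𝔠 • Σ Col ⟨e(𝔞)⟩`, `𝔞` liftable, `𝔠` ARBITRARY.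
[cite: deShalit1987, Ch. II §2.4 (ii), §4.12 (29); Ch. I §3.1, §3.4 Lemma (ii)] -/
theorem indexTraceₗ_colemanImage_eq_of_mul_pow_eq {β₁ β₂ β₃ : ∀ m, RelNormCoherentUnits hπ (E m)}
    (hβ₁ : ∀ m, (β₁ (m + 1)).baseNorm hπ (hmono (Nat.le_succ m)) = β₁ m)
    (hβ₂ : ∀ m, (β₂ (m + 1)).baseNorm hπ (hmono (Nat.le_succ m)) = β₂ m)
    (hβ₃ : ∀ m, (β₃ (m + 1)).baseNorm hπ (hmono (Nat.le_succ m)) = β₃ m)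
    (σ : absoluteGaloisGroup F) {g : PowerSeries 𝒪[F]} {s : ZMod d}
    (hg : ∀ m, ∃ a : ℕ, (∀ x : E m, σ • (x : AlgebraicClosure F) = (σ₀ ^ a) • (x : AlgebraicClosure F)) ∧
      ((1 + PowerSeries.X : PowerSeries 𝒪[F]) ^ p ^ m - 1) ∣ g - (1 + PowerSeries.X) ^ a ∧ (a : ZMod d) = s)
    {n : ℕ} (h : ∀ m, (β₁ m).galAct σ * β₂ m ^ n = β₃ m) :
    indexTraceₗ hπ hq u hu γ (colemanImage hd hπ E hmono hE hdeg hσ₀ hq u hu γ hθ hcoh hβ₃) =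
      unitTwistₗ hπ hq (intBase F) u hu γ (lubinTateChar hπ σ)
          ((PowerSeries.C g : PowerSeries (PowerSeries 𝒪[F])) •
            indexTraceₗ hπ hq u hu γ (colemanImage hd hπ E hmono hE hdeg hσ₀ hq u hu γ hθ hcoh hβ₁)) +
        (PowerSeries.C ((n : ℕ) : PowerSeries 𝒪[F]) : PowerSeries (PowerSeries 𝒪[F])) •
          indexTraceₗ hπ hq u hu γ (colemanImage hd hπ E hmono hE hdeg hσ₀ hq u hu γ hθ hcoh hβ₂) := by
  rw [colemanImage_eq_galOpₗ_add_smul_of_mul_pow_eq hd hπ E hmono hE hdeg hσ₀ hq u hu γ hθ hcoh hβ₁ hβ₂ hβ₃ σ hg h, map_add, map_smul,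
    indexTraceₗ_galOpₗ]

include hdeg in
/-- ★ **THE CONJUGATE-FAMILY READING** (II §2.4 (ii) at one prime): with `x := Σ Col β₂` (`= Σ Col ⟨e(𝔞)⟩`), `y := Σ Col β₁` (`= Σ Col ⟨e(𝔠)⟩`),
`𝒯 := σ_{χσ̃} ∘ (C g •)` and a scalar `N` (`= N𝔞`), the element `Σ Col β₃ − N • y` (`= Σ Col ⟨e(𝔞𝔠)⟩ − N𝔞 • Σ Col ⟨e(𝔠)⟩`, the `𝔓`-component of the
global conjugate `σ_𝔠 e(𝔞)` read additively) IS the conjugate-family element `C n • x + (𝒯 y − N • y)` of `CosetCocycle.conj_rel`.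
[cite: deShalit1987, Ch. II §2.4 (ii), §4.12 (33)] -/
theorem indexTraceₗ_colemanImage_sub_smul_eq_conj {β₁ β₂ β₃ : ∀ m, RelNormCoherentUnits hπ (E m)}
    (hβ₁ : ∀ m, (β₁ (m + 1)).baseNorm hπ (hmono (Nat.le_succ m)) = β₁ m)
    (hβ₂ : ∀ m, (β₂ (m + 1)).baseNorm hπ (hmono (Nat.le_succ m)) = β₂ m)
    (hβ₃ : ∀ m, (β₃ (m + 1)).baseNorm hπ (hmono (Nat.le_succ m)) = β₃ m)
    (σ : absoluteGaloisGroup F) {g : PowerSeries 𝒪[F]} {s : ZMod d}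
    (hg : ∀ m, ∃ a : ℕ, (∀ x : E m, σ • (x : AlgebraicClosure F) = (σ₀ ^ a) • (x : AlgebraicClosure F)) ∧
      ((1 + PowerSeries.X : PowerSeries 𝒪[F]) ^ p ^ m - 1) ∣ g - (1 + PowerSeries.X) ^ a ∧ (a : ZMod d) = s)
    {n : ℕ} (h : ∀ m, (β₁ m).galAct σ * β₂ m ^ n = β₃ m) (N : PowerSeries (PowerSeries 𝒪[F])) :
    indexTraceₗ hπ hq u hu γ (colemanImage hd hπ E hmono hE hdeg hσ₀ hq u hu γ hθ hcoh hβ₃) -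
        N • indexTraceₗ hπ hq u hu γ (colemanImage hd hπ E hmono hE hdeg hσ₀ hq u hu γ hθ hcoh hβ₁) =
      (PowerSeries.C ((n : ℕ) : PowerSeries 𝒪[F]) : PowerSeries (PowerSeries 𝒪[F])) •
          indexTraceₗ hπ hq u hu γ (colemanImage hd hπ E hmono hE hdeg hσ₀ hq u hu γ hθ hcoh hβ₂) +
        (unitTwistₗ hπ hq (intBase F) u hu γ (lubinTateChar hπ σ)
            ((PowerSeries.C g : PowerSeries (PowerSeries 𝒪[F])) •
              indexTraceₗ hπ hq u hu γ (colemanImage hd hπ E hmono hE hdeg hσ₀ hq u hu γ hθ hcoh hβ₁)) -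
          N • indexTraceₗ hπ hq u hu γ (colemanImage hd hπ E hmono hE hdeg hσ₀ hq u hu γ hθ hcoh hβ₁)) := by
  rw [indexTraceₗ_colemanImage_eq_of_mul_pow_eq hd hπ E hmono hE hdeg hσ₀ hq u hu γ hθ hcoh hβ₁ hβ₂ hβ₃ σ hg h]
  abel

/-! ### §4. On the `ε`-coinvariants: `φ_ε(Σ Col β₃) = (t·C g)·φ_ε(Σ Col β₁) + C n·φ_ε(Σ Col β₂)` -/

variable (w : 𝒪[F]ˣ) (hγ : (γ : 𝒪[F]) = 1 + π ^ 2 * w) (ε : PowerSeries (PowerSeries 𝒪[F])) (hε : ε * ε = 1)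

include hdeg hε in
/-- ★★★ **`φ_ε(Σ Col β₃) = (t_{χσ̃}·C g)·φ_ε(Σ Col β₁) + C n·φ_ε(Σ Col β₂)`**, `t_v = φ_ε(σ_v 1)`: the one-sided product rule on the `ε`-coinvariants,
where the Galois operator `σ_{χσ̃} ∘ (C g •)` is the SCALAR `t_{χσ̃}·C g` (`colemanDeltaCoinvFun_unitTwistₗ_smul`).  For the elliptic units:
`φ_ε(Σ Col ⟨e(𝔞𝔠)⟩) = (t_𝔞 C g_𝔞)·φ_ε(Σ Col ⟨e(𝔠)⟩) + N𝔠·φ_ε(Σ Col ⟨e(𝔞)⟩)` — `𝔠` need NOT be liftable.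
[cite: deShalit1987, Ch. II §2.4 (ii), §4.12 (29)–(33); Ch. I §3.1, §3.4 Lemma (ii); Ch. III §1.4 (5)] -/
theorem colemanDeltaCoinvFun_indexTraceₗ_colemanImage_eq_of_mul_pow_eq {β₁ β₂ β₃ : ∀ m, RelNormCoherentUnits hπ (E m)}
    (hβ₁ : ∀ m, (β₁ (m + 1)).baseNorm hπ (hmono (Nat.le_succ m)) = β₁ m)
    (hβ₂ : ∀ m, (β₂ (m + 1)).baseNorm hπ (hmono (Nat.le_succ m)) = β₂ m)
    (hβ₃ : ∀ m, (β₃ (m + 1)).baseNorm hπ (hmono (Nat.le_succ m)) = β₃ m)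
    (σ : absoluteGaloisGroup F) {g : PowerSeries 𝒪[F]} {s : ZMod d}
    (hg : ∀ m, ∃ a : ℕ, (∀ x : E m, σ • (x : AlgebraicClosure F) = (σ₀ ^ a) • (x : AlgebraicClosure F)) ∧
      ((1 + PowerSeries.X : PowerSeries 𝒪[F]) ^ p ^ m - 1) ∣ g - (1 + PowerSeries.X) ^ a ∧ (a : ZMod d) = s)
    {n : ℕ} (h : ∀ m, (β₁ m).galAct σ * β₂ m ^ n = β₃ m) :
    colemanDeltaCoinvFun hπ hq (intBase F) u hu γ (eq_zero_of_C_pi_mul_eq_zero_integer hπ) w hγ ε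
        (indexTraceₗ hπ hq u hu γ (colemanImage hd hπ E hmono hE hdeg hσ₀ hq u hu γ hθ hcoh hβ₃)) =
      colemanDeltaCoinvFun hπ hq (intBase F) u hu γ (eq_zero_of_C_pi_mul_eq_zero_integer hπ) w hγ ε
            (unitTwistₗ hπ hq (intBase F) u hu γ (lubinTateChar hπ σ) (TActModule.ofPS _ _ 1)) *
          (PowerSeries.C g : PowerSeries (PowerSeries 𝒪[F])) *
          colemanDeltaCoinvFun hπ hq (intBase F) u hu γ (eq_zero_of_C_pi_mul_eq_zero_integer hπ) w hγ ε
            (indexTraceₗ hπ hq u hu γ (colemanImage hd hπ E hmono hE hdeg hσ₀ hq u hu γ hθ hcoh hβ₁)) +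
        (PowerSeries.C ((n : ℕ) : PowerSeries 𝒪[F]) : PowerSeries (PowerSeries 𝒪[F])) *
          colemanDeltaCoinvFun hπ hq (intBase F) u hu γ (eq_zero_of_C_pi_mul_eq_zero_integer hπ) w hγ ε
            (indexTraceₗ hπ hq u hu γ (colemanImage hd hπ E hmono hE hdeg hσ₀ hq u hu γ hθ hcoh hβ₂)) := by
  rw [indexTraceₗ_colemanImage_eq_of_mul_pow_eq hd hπ E hmono hE hdeg hσ₀ hq u hu γ hθ hcoh hβ₁ hβ₂ hβ₃ σ hg h, map_add,
    colemanDeltaCoinvFun_unitTwistₗ_smul hπ hq (intBase F) u hu γ _ w hγ ε hε, map_smul, smul_eq_mul]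

include hdeg hε in
/-- ★★★ **THE SECOND COSET COMPONENT AT ONE PRIME**: if moreover `φ_ε(Σ Col β₂) = (t_{χσ̃}·C g − N)·L` (the (c)-capstone's `hL` at the liftable index
`𝔞`: `N = N𝔞`, `L = L_ε`), then **`φ_ε(Σ Col β₃) = (t_{χσ̃}·C g)·φ_ε(Σ Col β₁) + C n·(t_{χσ̃}·C g − N)·L`** — `φ_ε(Σ Col ⟨e(𝔞𝔠)⟩)` for a liftable `𝔞`
and an ARBITRARY `𝔠` is determined by `L_ε` and the ONE new constant `φ_ε(Σ Col ⟨e(𝔠)⟩)` (de Shalit's `μ_τ` for the coset `τ = σ_𝔠 D`; equivalently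
`φ_ε(Σ Col β₃ − N • Σ Col β₁) = (t_{χσ̃}·C g − N)·(n·L + φ_ε(Σ Col β₁))`, `CosetCocycle.apply_conj_eq`).
[cite: deShalit1987, Ch. II §2.4 (ii), §4.12 (29)–(33); Ch. III §1.3, §1.4 (5)] -/
theorem colemanDeltaCoinvFun_indexTraceₗ_colemanImage_eq_of_mul_pow_eq_of_eq_mul {β₁ β₂ β₃ : ∀ m, RelNormCoherentUnits hπ (E m)}
    (hβ₁ : ∀ m, (β₁ (m + 1)).baseNorm hπ (hmono (Nat.le_succ m)) = β₁ m)
    (hβ₂ : ∀ m, (β₂ (m + 1)).baseNorm hπ (hmono (Nat.le_succ m)) = β₂ m)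
    (hβ₃ : ∀ m, (β₃ (m + 1)).baseNorm hπ (hmono (Nat.le_succ m)) = β₃ m)
    (σ : absoluteGaloisGroup F) {g : PowerSeries 𝒪[F]} {s : ZMod d}
    (hg : ∀ m, ∃ a : ℕ, (∀ x : E m, σ • (x : AlgebraicClosure F) = (σ₀ ^ a) • (x : AlgebraicClosure F)) ∧
      ((1 + PowerSeries.X : PowerSeries 𝒪[F]) ^ p ^ m - 1) ∣ g - (1 + PowerSeries.X) ^ a ∧ (a : ZMod d) = s)
    {n : ℕ} (h : ∀ m, (β₁ m).galAct σ * β₂ m ^ n = β₃ m) (N L : PowerSeries (PowerSeries 𝒪[F]))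
    (hL : colemanDeltaCoinvFun hπ hq (intBase F) u hu γ (eq_zero_of_C_pi_mul_eq_zero_integer hπ) w hγ ε
        (indexTraceₗ hπ hq u hu γ (colemanImage hd hπ E hmono hE hdeg hσ₀ hq u hu γ hθ hcoh hβ₂)) =
      (colemanDeltaCoinvFun hπ hq (intBase F) u hu γ (eq_zero_of_C_pi_mul_eq_zero_integer hπ) w hγ ε
          (unitTwistₗ hπ hq (intBase F) u hu γ (lubinTateChar hπ σ) (TActModule.ofPS _ _ 1)) *
          (PowerSeries.C g : PowerSeries (PowerSeries 𝒪[F])) - N) * L) :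
    colemanDeltaCoinvFun hπ hq (intBase F) u hu γ (eq_zero_of_C_pi_mul_eq_zero_integer hπ) w hγ ε
        (indexTraceₗ hπ hq u hu γ (colemanImage hd hπ E hmono hE hdeg hσ₀ hq u hu γ hθ hcoh hβ₃)) =
      colemanDeltaCoinvFun hπ hq (intBase F) u hu γ (eq_zero_of_C_pi_mul_eq_zero_integer hπ) w hγ ε
            (unitTwistₗ hπ hq (intBase F) u hu γ (lubinTateChar hπ σ) (TActModule.ofPS _ _ 1)) *
          (PowerSeries.C g : PowerSeries (PowerSeries 𝒪[F])) *
          colemanDeltaCoinvFun hπ hq (intBase F) u hu γ (eq_zero_of_C_pi_mul_eq_zero_integer hπ) w hγ ε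
            (indexTraceₗ hπ hq u hu γ (colemanImage hd hπ E hmono hE hdeg hσ₀ hq u hu γ hθ hcoh hβ₁)) +
        (PowerSeries.C ((n : ℕ) : PowerSeries 𝒪[F]) : PowerSeries (PowerSeries 𝒪[F])) *
          ((colemanDeltaCoinvFun hπ hq (intBase F) u hu γ (eq_zero_of_C_pi_mul_eq_zero_integer hπ) w hγ ε
              (unitTwistₗ hπ hq (intBase F) u hu γ (lubinTateChar hπ σ) (TActModule.ofPS _ _ 1)) *
              (PowerSeries.C g : PowerSeries (PowerSeries 𝒪[F])) - N) * L) := by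
  rw [colemanDeltaCoinvFun_indexTraceₗ_colemanImage_eq_of_mul_pow_eq hd hπ E hmono hE hdeg hσ₀ hq u hu γ hθ hcoh w hγ ε hε hβ₁ hβ₂ hβ₃ σ hg h,
    hL]

include hdeg hε in
/-- ★★ **The conjugate component, `CosetCocycle` shape**: under the same hypotheses
`φ_ε(Σ Col β₃ − N • Σ Col β₁) = (t_{χσ̃}·C g − N)·(C n·L + φ_ε(Σ Col β₁))` — `L′ = N𝔠·L_ε + φ_ε(Σ Col ⟨e(𝔠)⟩)` is the constant of the conjugate cocycle
family `(σ_𝔠 e(𝔞))_𝔓` (`LubinTateColemanCoordCoinvariantCosetTwo`, `colemanDeltaCoinvFun_conj_eq`). [cite: deShalit1987, Ch. II §2.4 (ii), §4.12 (33)] -/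
theorem colemanDeltaCoinvFun_indexTraceₗ_colemanImage_sub_smul_eq {β₁ β₂ β₃ : ∀ m, RelNormCoherentUnits hπ (E m)}
    (hβ₁ : ∀ m, (β₁ (m + 1)).baseNorm hπ (hmono (Nat.le_succ m)) = β₁ m)
    (hβ₂ : ∀ m, (β₂ (m + 1)).baseNorm hπ (hmono (Nat.le_succ m)) = β₂ m)
    (hβ₃ : ∀ m, (β₃ (m + 1)).baseNorm hπ (hmono (Nat.le_succ m)) = β₃ m)
    (σ : absoluteGaloisGroup F) {g : PowerSeries 𝒪[F]} {s : ZMod d}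
    (hg : ∀ m, ∃ a : ℕ, (∀ x : E m, σ • (x : AlgebraicClosure F) = (σ₀ ^ a) • (x : AlgebraicClosure F)) ∧
      ((1 + PowerSeries.X : PowerSeries 𝒪[F]) ^ p ^ m - 1) ∣ g - (1 + PowerSeries.X) ^ a ∧ (a : ZMod d) = s)
    {n : ℕ} (h : ∀ m, (β₁ m).galAct σ * β₂ m ^ n = β₃ m) (N L : PowerSeries (PowerSeries 𝒪[F]))
    (hL : colemanDeltaCoinvFun hπ hq (intBase F) u hu γ (eq_zero_of_C_pi_mul_eq_zero_integer hπ) w hγ ε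
        (indexTraceₗ hπ hq u hu γ (colemanImage hd hπ E hmono hE hdeg hσ₀ hq u hu γ hθ hcoh hβ₂)) =
      (colemanDeltaCoinvFun hπ hq (intBase F) u hu γ (eq_zero_of_C_pi_mul_eq_zero_integer hπ) w hγ ε
          (unitTwistₗ hπ hq (intBase F) u hu γ (lubinTateChar hπ σ) (TActModule.ofPS _ _ 1)) *
          (PowerSeries.C g : PowerSeries (PowerSeries 𝒪[F])) - N) * L) :
    colemanDeltaCoinvFun hπ hq (intBase F) u hu γ (eq_zero_of_C_pi_mul_eq_zero_integer hπ) w hγ ε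
        (indexTraceₗ hπ hq u hu γ (colemanImage hd hπ E hmono hE hdeg hσ₀ hq u hu γ hθ hcoh hβ₃) -
          N • indexTraceₗ hπ hq u hu γ (colemanImage hd hπ E hmono hE hdeg hσ₀ hq u hu γ hθ hcoh hβ₁)) =
      (colemanDeltaCoinvFun hπ hq (intBase F) u hu γ (eq_zero_of_C_pi_mul_eq_zero_integer hπ) w hγ ε
            (unitTwistₗ hπ hq (intBase F) u hu γ (lubinTateChar hπ σ) (TActModule.ofPS _ _ 1)) *
          (PowerSeries.C g : PowerSeries (PowerSeries 𝒪[F])) - N) *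
        ((PowerSeries.C ((n : ℕ) : PowerSeries 𝒪[F]) : PowerSeries (PowerSeries 𝒪[F])) * L +
          colemanDeltaCoinvFun hπ hq (intBase F) u hu γ (eq_zero_of_C_pi_mul_eq_zero_integer hπ) w hγ ε
            (indexTraceₗ hπ hq u hu γ (colemanImage hd hπ E hmono hE hdeg hσ₀ hq u hu γ hθ hcoh hβ₁))) := by
  rw [map_sub, map_smul, smul_eq_mul,
    colemanDeltaCoinvFun_indexTraceₗ_colemanImage_eq_of_mul_pow_eq_of_eq_mul hd hπ E hmono hE hdeg hσ₀ hq u hu γ hθ hcoh w hγ ε hε hβ₁ hβ₂ hβ₃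
      σ hg h N L hL]
  ring

end TwoVariable

end Literature.NumberTheory.EllipticCurves

end
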